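import Summits.CriticalPhenomena.CardyFormulaZ2.Theorems.CardyWhiteToColouredSimilarityUpgradeStubDualSum
import Summits.CriticalPhenomena.CardyFormulaZ2.Theorems.CardyWhiteToColouredSimilarityUpgradeStubLimitDuality
import Summits.CriticalPhenomena.CardyFormulaZ2.Theorems.ModulusResponseSquarePinning
import Summits.CriticalPhenomena.CardyFormulaZ2.Theorems.RectilinearCardy.Negative.RectilinearCardySquareInstance
import Literature.Probability.Percolation.CardyFormula
import Literature.Probability.RandomPlanarGeometry.ModulusSymmetry

/-!
# Lattice-antisymmetric conformal rectangles are crossed with probability `→ 1/2`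
# (stub `stub_symmetricHalf`)

Sub-goal (W2-1a) of the `SimilarityUpgrade` crux (stmt-CriticalPhenomena-4597, lead c4, wave 2).
Let `R = (Ω; a, b, c, d)` be a conformal rectangle and `σ z = u z̄` with `u ∈ {1, -1, i, -i}` one of
the four anti-linear LATTICE symmetries of `ℤ²` (reflections in the real axis, the imaginary axis
and the two diagonals). If `σ(Ω) = Ω` and `σ` exchanges the two pairs of opposite arcs of `R`
(`σ(arc 0) = arc 1, σ(arc 2) = arc 3` or `σ(arc 0) = arc 3, σ(arc 2) = arc 1`), then
`bondDomainCrossingProb R δ → 1/2` as the mesh `δ → 0⁺` — unconditionally.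

Proof sketch. By the limit self-duality of the G02 discretisation of bond percolation on `ℤ²` at
`p = 1/2` (`stub_dualSum`, a theorem of the tree): for every conformal rectangle,
`P[C_δ(Ω; arc 0, arc 2)] + P[C_δ(Ω; arc 1, arc 3)] → 1`. Every `σ` as above is a composite of the
generating cell symmetries `CellSymmetry.reflect` (`z ↦ z̄`) and `CellSymmetry.rot` (`z ↦ i z`) of
`ℤ²`, each of which is an exact symmetry of the crossing probability at every mesh
(`ModulusResponseSquarePinning.discreteCrossingProb_image_plane`); hence
`P[C_δ(σΩ; σ arc 0, σ arc 2)] = P[C_δ(Ω; arc 0, arc 2)]` (`symmetricHalf_discreteCrossingProb_image`).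
The left side is `P[C_δ(Ω; arc 1, arc 3)]` (first case) or `P[C_δ(Ω; arc 3, arc 1)]`, which is the
same number since the crossing event is symmetric in its two arcs (`discreteCrossingProb_arc_swap`).
So the dual sum at `R` reads `2 · bondDomainCrossingProb R δ → 1`.

Bonus (`cardy_of_symmetricHalf`): if moreover `σ` fixes the marked points `a, c` and maps `b` to
`d`, the modulus of `R` is `1/2` (symmetry principle,
`ConformalRectangle.crossRatio_eq_half_of_antiAffine`) and `F(1/2) = 1/2` (`cardyFunction_half`),
so this is Cardy's formula for the lattice-symmetric family. This generalises the L-quad instance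
`stub_lShapeHalf` / `cardy_lShapeQuad_of_dualSum`.

References: S. Smirnov, *Critical percolation in the plane*, C. R. Acad. Sci. Paris 333 (2001),
§2; G. R. Grimmett, *Percolation* (1999), §9.7 and Lemma 11.21 (self-duality at `p = 1/2`);
V. Beffara, *Cardy's formula on the triangular lattice, the easy way* (2007), proof of Prop. 4
("by symmetry"); J. Cardy, J. Phys. A 25 (1992) L201.
-/

noncomputable section

namespace Summit.CriticalPhenomena.CardyFormulaZ2.Cruxes.SimilarityUpgrade.Stubs

open Filter Topology Set MeasureTheory
open Literature.Probability.RandomPlanarGeometry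
open Literature.Probability.Percolation
open scoped ComplexConjugate
open Complex (I)
open Literature.Probability.LatticeModels (CellSymmetry)
open Summit.CriticalPhenomena.CardyFormulaZ2.Theorems.RectilinearCardy.Negative (cardyFunction_half)
open Summit.CriticalPhenomena.CardyFormulaZ2.Theorems.ModulusResponseSquarePinning
  (discreteCrossingProb_image_plane)

/-! ### Lattice symmetries of the crossing probability -/

/-- Post-composing with the quarter turn: the image under `z ↦ i · f z` is the image under the
plane action of `CellSymmetry.rot` of the image under `f`. [folklore] -/
theorem symmetricHalf_image_mul_I_comp (f : ℂ → ℂ) (X : Set ℂ) :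
    (fun z : ℂ => I * f z) '' X = CellSymmetry.rot.plane '' (f '' X) := by
  rw [Set.image_image]
  exact image_congr fun z _ => (CellSymmetry.rot_plane_apply (f z)).symm

/-- The image under complex conjugation is the image under the plane action of
`CellSymmetry.reflect`. [folklore] -/
theorem symmetricHalf_image_conj (X : Set ℂ) :
    (fun z : ℂ => conj z) '' X = CellSymmetry.reflect.plane '' X :=
  image_congr fun z _ => (CellSymmetry.reflect_plane_apply z).symm

/-- If `f` is an exact symmetry of G02's bond crossing probability (mesh by mesh), then so is
`z ↦ i · f z` (one more application of `discreteCrossingProb_image_plane`). [folklore] -/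
theorem symmetricHalf_discreteCrossingProb_image_mul_I_comp {f : ℂ → ℂ}
    (hf : ∀ (p : unitInterval) (Ω : Set ℂ) (δ : ℝ) (A B : Set ℂ),
      discreteCrossingProb p (f '' Ω) δ (f '' A) (f '' B) = discreteCrossingProb p Ω δ A B)
    (p : unitInterval) (Ω : Set ℂ) (δ : ℝ) (A B : Set ℂ) :
    discreteCrossingProb p ((fun z : ℂ => I * f z) '' Ω) δ ((fun z : ℂ => I * f z) '' A)
        ((fun z : ℂ => I * f z) '' B) =
      discreteCrossingProb p Ω δ A B := by
  rw [symmetricHalf_image_mul_I_comp, symmetricHalf_image_mul_I_comp,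
    symmetricHalf_image_mul_I_comp, discreteCrossingProb_image_plane, hf]

/-- Complex conjugation (the reflection `CellSymmetry.reflect` of `ℤ²`) is an exact symmetry of
G02's bond crossing probability, mesh by mesh. [folklore] -/
theorem symmetricHalf_discreteCrossingProb_image_conj (p : unitInterval) (Ω : Set ℂ) (δ : ℝ)
    (A B : Set ℂ) :
    discreteCrossingProb p ((fun z : ℂ => conj z) '' Ω) δ ((fun z : ℂ => conj z) '' A)
        ((fun z : ℂ => conj z) '' B) =
      discreteCrossingProb p Ω δ A B := by
  rw [symmetricHalf_image_conj, symmetricHalf_image_conj, symmetricHalf_image_conj,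
    discreteCrossingProb_image_plane]

/-- **Every anti-linear lattice symmetry `σ z = u z̄`, `u ∈ {1, -1, i, -i}`, is an exact symmetry
of G02's bond crossing probability**, mesh by mesh: `σ` is `conj` followed by `0, 2, 1, 3` quarter
turns. [folklore] -/
theorem symmetricHalf_discreteCrossingProb_image {u : ℂ}
    (hu : u = 1 ∨ u = -1 ∨ u = Complex.I ∨ u = -Complex.I) (p : unitInterval) (Ω : Set ℂ)
    (δ : ℝ) (A B : Set ℂ) :
    discreteCrossingProb p ((fun z : ℂ => u * conj z) '' Ω) δ ((fun z : ℂ => u * conj z) '' A)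
        ((fun z : ℂ => u * conj z) '' B) =
      discreteCrossingProb p Ω δ A B := by
  have h1 := symmetricHalf_discreteCrossingProb_image_mul_I_comp
    symmetricHalf_discreteCrossingProb_image_conj
  have h2 := symmetricHalf_discreteCrossingProb_image_mul_I_comp h1
  have h3 := symmetricHalf_discreteCrossingProb_image_mul_I_comp h2
  rcases hu with rfl | rfl | rfl | rfl
  · have e : (fun z : ℂ => (1 : ℂ) * conj z) = fun z : ℂ => conj z := funext fun z => one_mul _
    rw [e]
    exact symmetricHalf_discreteCrossingProb_image_conj p Ω δ A B
  · have e : (fun z : ℂ => (-1 : ℂ) * conj z) = fun z : ℂ => I * (I * conj z) :=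
      funext fun z => by rw [← mul_assoc, Complex.I_mul_I]
    rw [e]
    exact h2 p Ω δ A B
  · exact h1 p Ω δ A B
  · have e : (fun z : ℂ => -I * conj z) = fun z : ℂ => I * (I * (I * conj z)) :=
      funext fun z => by rw [← mul_assoc I I, Complex.I_mul_I, neg_one_mul, neg_mul]
    rw [e]
    exact h3 p Ω δ A B

/-! ### The stub -/

/-- **Lattice-antisymmetric conformal rectangles are crossed with probability `→ 1/2`**: if an
anti-linear lattice symmetry `σ z = u z̄` (`u ∈ {1, -1, i, -i}`) preserves the carrier of `R` and
exchanges its two pairs of opposite arcs, then the dual crossing probability of `R` equals its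
crossing probability at every mesh, so the dual sum `→ 1` (`stub_dualSum`) reads
`2 · bondDomainCrossingProb R δ → 1`. [folklore] -/
theorem stub_symmetricHalf :
    ∀ (R : ConformalRectangle) (u : ℂ), (u = 1 ∨ u = -1 ∨ u = Complex.I ∨ u = -Complex.I) →
      (fun z : ℂ => u * (starRingEnd ℂ) z) '' R.carrier = R.carrier →
      ((fun z : ℂ => u * (starRingEnd ℂ) z) '' R.arc 0 = R.arc 1 ∧
          (fun z : ℂ => u * (starRingEnd ℂ) z) '' R.arc 2 = R.arc 3 ∨
        (fun z : ℂ => u * (starRingEnd ℂ) z) '' R.arc 0 = R.arc 3 ∧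
          (fun z : ℂ => u * (starRingEnd ℂ) z) '' R.arc 2 = R.arc 1) →
      Tendsto (bondDomainCrossingProb R) (𝓝[>] (0 : ℝ)) (𝓝 (1 / 2)) := by
  intro R u hu hΩ harcs
  -- the dual crossing probability equals the crossing probability, mesh by mesh
  have hdual : ∀ δ : ℝ,
      discreteCrossingProb half R.carrier δ (R.arc 1) (R.arc 3) = bondDomainCrossingProb R δ := by
    intro δ
    rcases harcs with ⟨h0, h2⟩ | ⟨h0, h2⟩
    · calc discreteCrossingProb half R.carrier δ (R.arc 1) (R.arc 3)
          = discreteCrossingProb half ((fun z : ℂ => u * conj z) '' R.carrier) δ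
              ((fun z : ℂ => u * conj z) '' R.arc 0) ((fun z : ℂ => u * conj z) '' R.arc 2) := by
            rw [hΩ, h0, h2]
        _ = bondDomainCrossingProb R δ := symmetricHalf_discreteCrossingProb_image hu _ _ _ _ _
    · calc discreteCrossingProb half R.carrier δ (R.arc 1) (R.arc 3)
          = discreteCrossingProb half R.carrier δ (R.arc 3) (R.arc 1) :=
            discreteCrossingProb_arc_swap _ _ _ _ _
        _ = discreteCrossingProb half ((fun z : ℂ => u * conj z) '' R.carrier) δ
              ((fun z : ℂ => u * conj z) '' R.arc 0) ((fun z : ℂ => u * conj z) '' R.arc 2) := by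
            rw [hΩ, h0, h2]
        _ = bondDomainCrossingProb R δ := symmetricHalf_discreteCrossingProb_image hu _ _ _ _ _
  -- the dual sum at `R` reads `2 · bond R δ → 1`
  have hsum : Tendsto (fun δ : ℝ => bondDomainCrossingProb R δ + bondDomainCrossingProb R δ)
      (𝓝[>] (0 : ℝ)) (𝓝 1) :=
    (stub_dualSum R).congr fun δ => by rw [hdual]
  refine (hsum.div_const 2).congr fun δ => ?_
  ring

/-! ### Bonus: Cardy's formula for the lattice-symmetric family -/

/-- **Cardy's formula for lattice-symmetric conformal rectangles.** If an anti-linear lattice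
symmetry `σ z = u z̄` (`u ∈ {1, -1, i, -i}`) preserves the carrier of `R = (Ω; a, b, c, d)`,
exchanges its two pairs of opposite arcs, fixes `a` and `c` and maps `b` to `d`, then the modulus
of `R` is `1/2` (symmetry principle `crossRatio_eq_half_of_antiAffine`), `F(1/2) = 1/2`
(`cardyFunction_half`), and `bondDomainCrossingProb R δ → 1/2 = F(1/2)` (`stub_symmetricHalf`).
[folklore] -/
theorem cardy_of_symmetricHalf (R : ConformalRectangle) (u : ℂ)
    (hu : u = 1 ∨ u = -1 ∨ u = Complex.I ∨ u = -Complex.I)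
    (hΩ : (fun z : ℂ => u * (starRingEnd ℂ) z) '' R.carrier = R.carrier)
    (harcs : (fun z : ℂ => u * (starRingEnd ℂ) z) '' R.arc 0 = R.arc 1 ∧
          (fun z : ℂ => u * (starRingEnd ℂ) z) '' R.arc 2 = R.arc 3 ∨
        (fun z : ℂ => u * (starRingEnd ℂ) z) '' R.arc 0 = R.arc 3 ∧
          (fun z : ℂ => u * (starRingEnd ℂ) z) '' R.arc 2 = R.arc 1)
    (h0 : u * (starRingEnd ℂ) (R.pt 0) = R.pt 0) (h2 : u * (starRingEnd ℂ) (R.pt 2) = R.pt 2)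
    (h1 : u * (starRingEnd ℂ) (R.pt 1) = R.pt 3) :
    R.HasCrossingLimit (bondDomainCrossingProb R)
      Literature.Probability.RandomPlanarGeometry.cardyFunction := by
  intro φ x hφx
  have hnorm : ‖u‖ = 1 := by
    rcases hu with rfl | rfl | rfl | rfl <;> simp
  have hmaps : MapsTo (antiAffine u 0) R.carrier R.carrier := by
    intro z hz
    rw [← hΩ]
    exact ⟨z, hz, by rw [antiAffine_apply, add_zero]⟩
  have hη : crossRatio x = 1 / 2 :=
    R.crossRatio_eq_half_of_antiAffine hnorm (by simp) hmaps
      (by rw [antiAffine_apply, add_zero]; exact h0) (by rw [antiAffine_apply, add_zero]; exact h2)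
      (by rw [antiAffine_apply, add_zero]; exact h1) hφx
  rw [hη, cardyFunction_half]
  exact stub_symmetricHalf R u hu hΩ harcs

end Summit.CriticalPhenomena.CardyFormulaZ2.Cruxes.SimilarityUpgrade.Stubs

end
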